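import Mathlib.Tactic.Linarith
import Mathlib.Tactic.Ring
import HarnessLib

/-!
# Crux `Steer` (stmt-ResolutionOfSingularities-16345), chain W4.1, F-B-wild fork (Par-S) «infinitely many parameter switches», K4 ⇐ K4a + K4b:
# **K4b — THE MONOMIAL PHASE DIES: the arithmetic certificates** (res-L0-w41-idea-1 g8, `BINARY-RESIDUE-g8.md` 62b838ca0d66e55e §2.2 / §5.1–5.2)

OURS (campaign `res-hironaka`, rung L ★L-G4, slot W4.1; seat res-type-096 g9 on res-L0-w41-plan-1 RULING 111b (iii) / 113f; statements = idea-1 g8's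
hand eliminations, typed and kernel-checked here; replaces the role of no printed item; NOT a statement of the manuscript under review
[claim: Hironaka2017, status: under-review]; AI-produced, weaker than expert review). Theses-free and definition-free; pure `ℕ`-arithmetic.

SETTING (idea-1 g8 §5.1, words only — the dictionary «exponents ↔ torsor data» is K4a's business and is NOT asserted here). At a late A-stage of a
binary-residue tail with stable odd order `d ≥ 3`, in prepared cleaned coordinates, the MONOMIAL normal form `C(a₀, b₀, b₁)` has level 1
`= y^{b₁}·unit·ℓ(z,w)` (`a₁ = 0`, `b₁ ≥ d`) and level 0 `= x^{a₀} y^{b₀}·unit` with `b₀ ≤ 1`, `a₀ + b₀ ≥ d + 1`. A block is a word `σ_x σ_y^m σ_x`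
or `σ_y σ_x^m σ_y` (`m` satellites) in the chart maps `σ_x (α, β) = (α + β − 1, β)`, `σ_y (α, β) = (α, α + β − 1)`; «S» = order-stability through the
word (composite inequality of §2.2), «L» = axis legality at the A-stage reached (the exponent of the new exceptional parameter at level 0 is `≤ 1`,
else the axis curve `V(u, z, w)` lies in the singular locus and σ_top takes a height-`≥ 2` step). THIS FILE PROVES, for every `m`, that S ∧ L is
INCONSISTENT with `d ≥ 3` for the four satellite/free `x`-moves, and pins the free `y`-block to the single survivor `C(d, 1, b₁) ↦ C(d, 1, b₁ − 2(d−1))`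
with `b₁` strictly decreasing — idea-1's «no switch is even possible in the monomial phase; the tail dies after `≤ ⌊b₁/(2(d−1))⌋ + 1` blocks».
The two all-`m` eliminations are the `nlinarith` certificates `(m+1)·S + (2m+1)·L`, `(m+1)·S + (2m+3)·L` idea-1 names.

* `satelliteX_forces_d_le_two` — word `σ_x σ_y^m σ_x`, `m ≥ 1`: S `(4m+3)d ≤ (2m+1)a₀ + (2m+3)b₀` ∧ L `(m+1)a₀ + (m+2)b₀ ≤ 2(m+1)d + 1` ⇒ `d ≤ 2`.
* `satelliteY_forces_d_le_two` — word `σ_y σ_x^m σ_y`, `m ≥ 1`: S `(4m+3)d ≤ (2m+3)a₀ + (2m+1)b₀` ∧ L `(m+1)a₀ + m·b₀ ≤ 2m·d + 1` ⇒ `d ≤ 2`.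
* `freeX_forces_d_le_two` — free `x`-block: S `3d ≤ a₀ + 3b₀` ∧ L `a₀ + 2b₀ ≤ 2d + 1` ⇒ `d ≤ 2`.
* `shearedX_forces_d_le_two` — sheared `x`-block: S at level 1 `3(d−1) ≤ b₁` and at level 0 `3d ≤ a₀ + 3b₀`, after the word the level-0 `x`-exponent
  `a₀ + 2b₀ − 2d ≥ d − b₀`; L `≤ 1` ⇒ `d ≤ 2`.
* `freeY_survivor` — free `y`-block: degree `d + 1 ≤ a₀ + b₀`, `b₀ ≤ 1`, L `2a₀ + b₀ ≤ 2d + 1` ⇒ `a₀ = d ∧ b₀ = 1`; `freeY_level_one_decreases` — its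
  S-condition `3(d−1) ≤ b₁` gives `b₁ − 2(d−1) < b₁` and the new value is again `≥ d − 1`; `freeY_blocks_bound` — at most `b₁ / (2(d−1)) + 1` such blocks.
* `composite_satelliteX` — the composite of §2.2: `σ_x σ_y^m σ_x (α, β) = ((m+1)α + (m+2)β − 2(m+1), mα + (m+1)β − 2m)` on `ℤ²` (by induction on `m`).

[folklore]
-/

-- `Summit.<S>.<S>.…` duplicates the summit name by design (single-problem summit).
set_option linter.dupNamespace false

namespace Summit.ResolutionOfSingularities.ResolutionOfSingularities.Theorems.SwitchingDichotomy

namespace BinaryResidueMonomialPhase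

/-! ## §1 The chart letters on the polyhedron plane and the composite of a satellite word -/

/-- **The composite of the satellite word `σ_x σ_y^m σ_x`** on the exponent plane (idea-1 g8 §2.2), with `σ_x (α, β) = (α + β − 1, β)` and
`σ_y (α, β) = (α, α + β − 1)` acting on `ℤ × ℤ` (integer exponents at a fixed level; the printed `(α, β)` are these divided by `d − j`, here
scaled so that the letters read `(a, b) ↦ (a + b − e, b)` / `(a, a + b − e)` with `e = d − j`): after `σ_x`, `m` letters `σ_y` and the closing
`σ_x`, `(a, b) ↦ ((m+1)a + (m+2)b − 2(m+1)e, m·a + (m+1)b − 2m·e)`. [folklore] -/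
theorem composite_satelliteX (e : ℤ) (m : ℕ) (a b : ℤ) :
    (fun p : ℤ × ℤ => (p.1 + p.2 - e, p.2))
      ((fun p : ℤ × ℤ => (p.1, p.1 + p.2 - e))^[m] ((fun p : ℤ × ℤ => (p.1 + p.2 - e, p.2)) (a, b))) =
      (((m : ℤ) + 1) * a + ((m : ℤ) + 2) * b - 2 * ((m : ℤ) + 1) * e, (m : ℤ) * a + ((m : ℤ) + 1) * b - 2 * (m : ℤ) * e) := by
  -- the `m`-fold `σ_y` on `(a + b − e, b)`: `(a + b − e, m(a + b − e) + b − m e)`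
  have key : ∀ n : ℕ, (fun p : ℤ × ℤ => (p.1, p.1 + p.2 - e))^[n] (a + b - e, b) =
      (a + b - e, (n : ℤ) * (a + b - e) + b - (n : ℤ) * e) := by
    intro n
    induction n with
    | zero => simp
    | succ n ih =>
      rw [Function.iterate_succ_apply', ih]
      ext <;> push_cast <;> ring
  show (fun p : ℤ × ℤ => (p.1 + p.2 - e, p.2)) ((fun p : ℤ × ℤ => (p.1, p.1 + p.2 - e))^[m] (a + b - e, b)) = _
  rw [key m]
  ext <;> ring

/-! ## §2 The satellite blocks die (all `m ≥ 1`) -/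

/-- **Satellite `x`-blocks `σ_x σ_y^m σ_x` (`m ≥ 1`) are inconsistent with `d ≥ 3` in the monomial phase** (idea-1 g8 §5.2, third bullet):
order-stability at level 0 through the word, `(2m+1)a₀ + (2m+3)b₀ ≥ (4m+3)d`, and axis legality at the A-stage reached,
`a₀' = (m+1)a₀ + (m+2)b₀ − 2(m+1)d ≤ 1`, with `b₀ ≤ 1`, force `d ≤ 2` (certificate `(m+1)·S + (2m+1)·L`: `(m+1)d ≤ 2m + 1 + b₀`). [folklore] -/
theorem satelliteX_forces_d_le_two (m d a₀ b₀ : ℕ) (hb : b₀ ≤ 1)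
    (hS : (4 * m + 3) * d ≤ (2 * m + 1) * a₀ + (2 * m + 3) * b₀)
    (hL : (m + 1) * a₀ + (m + 2) * b₀ ≤ 2 * (m + 1) * d + 1) : d ≤ 2 := by
  nlinarith [hS, hL, hb]

/-- **Satellite `y`-blocks `σ_y σ_x^m σ_y` (`m ≥ 1`) are inconsistent with `d ≥ 3`** (idea-1 g8 §5.2, fourth bullet): S
`(2m+3)a₀ + (2m+1)b₀ ≥ (4m+3)d`, L `a₀' = (m+1)a₀ + m·b₀ − 2m·d ≤ 1`, `b₀ ≤ 1` ⇒ `d ≤ 2` (certificate `(m+1)·S + (2m+3)·L`; holds for every `m`).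
[folklore] -/
theorem satelliteY_forces_d_le_two (m d a₀ b₀ : ℕ) (hb : b₀ ≤ 1)
    (hS : (4 * m + 3) * d ≤ (2 * m + 3) * a₀ + (2 * m + 1) * b₀)
    (hL : (m + 1) * a₀ + m * b₀ ≤ 2 * m * d + 1) : d ≤ 2 := by
  nlinarith [hS, hL, hb]

/-! ## §3 The free and sheared `x`-blocks die -/

/-- **The free `x`-block dies** (idea-1 g8 §5.2, first bullet): S `a₀ + 3b₀ ≥ 3d`; after the word the level-0 `x`-exponent is
`a₀' = a₀ + 2b₀ − 2d`, and legality `a₀' ≤ 1` (the level-1 `x`-exponent `2b₁ − 2(d−1) ≥ 2` being automatic) forces `d ≤ 1 + b₀ ≤ 2`. [folklore] -/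
theorem freeX_forces_d_le_two (d a₀ b₀ : ℕ) (hb : b₀ ≤ 1) (hS : 3 * d ≤ a₀ + 3 * b₀)
    (hL : a₀ + 2 * b₀ ≤ 2 * d + 1) : d ≤ 2 := by
  omega

/-- The level-1 `x`-exponent after a free or sheared `x`-block, `2b₁ − 2(d−1)` resp. `≥ b₁ − 2d + 2`, is `≥ 1` as soon as `b₁ ≥ d ≥ 2`
(so the legality test is decided at level 0). [folklore] -/
theorem levelOne_after_X_pos (d b₁ : ℕ) (hd : 2 ≤ d) (hb₁ : d ≤ b₁) : 1 ≤ 2 * b₁ - 2 * (d - 1) ∧ (3 * (d - 1) ≤ b₁ → 1 ≤ b₁ - (2 * d - 2)) := by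
  omega

/-- **The sheared `x`-block dies** (idea-1 g8 §5.2, second bullet): the shear adds level-1 points `(b₁, 0), …`, stability needs `b₁ ≥ 3(d−1)`
and `a₀ + 3b₀ ≥ 3d`; afterwards every level-1 `x`-exponent is `≥ b₁ − 2d + 2 ≥ d − 1 ≥ 1` and the level-0 `x`-exponents are
`≥ a₀ + 2b₀ − 2d ≥ d − b₀ ≥ 2`, so the axis curve is singular: legality `a₀ + 2b₀ − 2d ≤ 1` forces `d ≤ 2`. [folklore] -/
theorem shearedX_forces_d_le_two (d a₀ b₀ b₁ : ℕ) (hb : b₀ ≤ 1) (_hS₁ : 3 * (d - 1) ≤ b₁) (hS₀ : 3 * d ≤ a₀ + 3 * b₀)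
    (hL : a₀ + 2 * b₀ ≤ 2 * d + 1) : d ≤ 2 := by
  omega

/-! ## §4 The free `y`-block: the single survivor, and it terminates -/

/-- **The free `y`-block survivor** (idea-1 g8 §5.2, last bullet): with degree `a₀ + b₀ ≥ d + 1`, `b₀ ≤ 1`, legality at the new A-stage
`b₀' = 2a₀ + b₀ − 2d ≤ 1` forces `a₀ = d ∧ b₀ = 1` — the configuration `C(d, 1, b₁)`. [folklore] -/
theorem freeY_survivor (d a₀ b₀ : ℕ) (hb : b₀ ≤ 1) (hdeg : d + 1 ≤ a₀ + b₀) (hL : 2 * a₀ + b₀ ≤ 2 * d + 1) :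
    a₀ = d ∧ b₀ = 1 := by
  omega

/-- **Along the survivor the level-1 exponent strictly decreases and stays in the normal form**: S `3(d−1) ≤ b₁` (with `d ≥ 2`) gives
`b₁ − 2(d−1) < b₁` and `b₁ − 2(d−1) ≥ d − 1`. [folklore] -/
theorem freeY_level_one_decreases (d b₁ : ℕ) (hd : 2 ≤ d) (hS : 3 * (d - 1) ≤ b₁) :
    b₁ - 2 * (d - 1) < b₁ ∧ d - 1 ≤ b₁ - 2 * (d - 1) := by
  omega

/-- **The sheared free `y`-block dies** (idea-1 g8 §5.2: the shear point `(i₀, d + 1 − i₀)` at level 0 would need `a₀ + b₀ ≥ 3d − 2` for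
stability, false since `a₀ + b₀ = d + 1` unless `d ≤ 2`). [folklore] -/
theorem shearedY_dies (d a₀ b₀ : ℕ) (ha : a₀ = d) (hb : b₀ = 1) : ¬ 3 * d - 2 ≤ a₀ + b₀ - 1 ∨ d ≤ 2 := by
  omega

/-- **Termination of the survivor run** (idea-1 g8 §5.2 CONCLUSION): a sequence `b : ℕ → ℕ` with `b (n+1) + 2(d−1) = b n` whenever
`3(d−1) ≤ b n` cannot satisfy `3(d−1) ≤ b n` for all `n ≤ N` once `N · 2(d−1) > b 0`: the free `y`-blocks stop after at most
`b₁ / (2(d−1)) + 1` blocks. [folklore] -/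
theorem freeY_blocks_bound (d : ℕ) (b : ℕ → ℕ)
    (hstep : ∀ n, 3 * (d - 1) ≤ b n → b (n + 1) + 2 * (d - 1) = b n)
    (N : ℕ) (hN : ∀ n, n ≤ N → 3 * (d - 1) ≤ b n) : N * (2 * (d - 1)) ≤ b 0 := by
  -- `b n + n · 2(d−1) = b 0` for `n ≤ N` by induction (within the stable range)
  have key : ∀ n, n ≤ N → b n + n * (2 * (d - 1)) = b 0 := by
    intro n
    induction n with
    | zero => intro; simp
    | succ n ih =>
      intro hn
      have h1 := ih (Nat.le_of_succ_le hn)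
      have h2 := hstep n (hN n (Nat.le_of_succ_le hn))
      rw [← h1, ← h2]
      ring
  have := key N le_rfl
  omega

end BinaryResidueMonomialPhase

end Summit.ResolutionOfSingularities.ResolutionOfSingularities.Theorems.SwitchingDichotomy
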